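import Mathlib.Algebra.MvPolynomial.Rename
import Mathlib.Algebra.BigOperators.Ring.Finset
import Mathlib.GroupTheory.GroupAction.Support
import Mathlib.GroupTheory.GroupAction.Defs
import Mathlib.Algebra.Group.Action.Sum
import Mathlib.Algebra.Group.Action.Prod
import Mathlib.Order.WellFounded
import HarnessLib

/-!
# Symmetric arithmetic circuits (Dawar–Wilsenach)

Trunk T-CPLX-ALG. Definition request `defn-SymmetricArithmeticCircuit` of route
`MatrixMultiplication/PriceOfSymmetry` (informal crux `SymmetricCircuitsCubic`: an `Ω(n³)` size
lower bound for `S_n`-symmetric circuits computing the `n × n` matrix product).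

A. Dawar, G. Wilsenach, *Symmetric Arithmetic Circuits*, Theory of Computing 21 (14) (2025)
1–32 (journal version of ICALP 2020, LIPIcs 168:36; arXiv:2002.06451):

* **Def. 2.2 (Circuit).** A circuit over the basis `B = {+, ×}` with variables `X` and constants
  `K` is a directed acyclic graph with a labelling in which each vertex of in-degree `0` is
  labelled by an element of `X ∪ K` and each vertex of in-degree `> 0` by `+` or `×` (unbounded
  fan-in); `child(g) = {h : (h, g) ∈ W}`; the size is the number of gates; "distinct input gates
  have distinct labels". Over a field the circuit expresses a polynomial in `K[X]` by the evident
  recursion (§2, §3.3: variables ↦ formal variables, `+`, `×` ↦ ring operations).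
* **Def. 3.6 (Circuit automorphism).** For `σ ∈ Sym(X)`, a bijection `π : G → G` is an
  automorphism extending `σ` if constant gates are fixed, a non-constant input gate labelled `x`
  goes to the one labelled `σ x`, wires go to wires, and basis labels are preserved; the circuit
  is *rigid* if every `σ` has at most one extension.
* **Def. 3.7 (Symmetric circuit).** For `Γ ≤ Sym(X)`, `C` is `Γ`-symmetric if the action of every
  `σ ∈ Γ` on `X` extends to an automorphism of `C`.
* **Def. 6.1 (Support).** In a rigid `Γ`-symmetric circuit with variables `{x_ij : i, j ∈ [n]}`, a
  set `S ⊆ [n]` is a support of a gate `g` if `Stab(S) ≤ Stab(g)` (pointwise stabiliser of `S` in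
  the induced action of `Sym_n`); `sp(g)` = least size of a support, `SP(C) = max_g sp(g)`.
  (Anderson–Dawar, Theory Comput. Syst. 60 (2017), Defs. 4–8, 11 for the Boolean originals.)

## Lean rendering

* `LabelledArithCircuit K X Y G` — Def. 2.2 on a gate type `G` (finite in applications): children
  as `children : G → Finset G` (the wire relation `W`, no parallel wires), `label : G →
  CircuitLabel K X` (`var x | const c | add | mul`), acyclicity as well-foundedness of the child
  relation, the in-degree/label consistency of Def. 2.2 (`isInput_iff`), injectivity of labels on
  input gates, and — the one GENERALISATION asked for by the route — a family of designated output
  gates `output : Y → G` indexed by a `Γ`-set `Y` (Dawar–Wilsenach take a single output gate,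
  `Y = Unit`; the matrix product has `n²` outputs `C_ik`), injective as in Anderson–Dawar Def. 4.
  `eval` is the polynomial semantics (well-founded recursion; `eval_eq`), `size = Fintype.card G`.
* `IsAutomorphismExtending C γ π` — Def. 3.6 for `γ` in a group `Γ` acting on `X` (and `Y`):
  `children (π g) = π '' children g`, `label (π g) = γ • label g` (so `+`/`×` preserved, the input
  labelled `x` goes to the input labelled `γ • x`, and a constant gate goes to the constant gate
  with the same constant, i.e. — labels being injective on inputs — is fixed), and
  `output (γ • y) = π (output y)`. `IsSymmetric Γ C` is Def. 3.7 verbatim (every `γ` extends to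
  some automorphism); `IsRigid` is rigidity.
* `SymmetricArithmeticCircuit Γ K X Y G` — the requested notion, in the bundled form suggested
  by the request ("equivalently: the group `Γ` acts on gates by circuit automorphisms compatibly
  with its action on `X` and `Y`"): a labelled circuit on a `Γ`-set of gates (`[MulAction Γ G]`)
  whose action maps are automorphisms extending the group elements. It `IsSymmetric`
  (`SymmetricArithmeticCircuit.isSymmetric`); conversely a RIGID symmetric circuit carries a
  unique such action (Dawar–Wilsenach's standing convention "we write `σ g`", after Def. 3.6 /
  Anderson–Dawar Prop. 9; not constructed here). With the action bundled, stabilisers, orbits and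
  supports are Mathlib's `MulAction.stabilizer`, `MulAction.orbit`, `MulAction.Supports`
  (`IsSupport`, `minSupportSize`, `supportSize` below, Def. 6.1), and symmetric circuits compute
  equivariant polynomials (`eval_smul`: `eval (γ • g) = rename (γ • ·) (eval g)`, the remark after
  Def. 3.7).
* The matrix-product instance: variables `MatMulVar n = (Fin n × Fin n) ⊕ (Fin n × Fin n)`
  (`A_ij | B_jk`), outputs `Fin n × Fin n` (`C_ik`), `Γ = Equiv.Perm (Fin n)` acting diagonally
  on indices (Mathlib's product/sum actions), `matMulEntry n i k = Σ_j A_ij B_jk`,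
  `ComputesMatrixProduct`.

Mathlib has no circuits (searched `ArithCircuit`, `Circuit`, `straight-line`); the tree's
`Literature.Computability.AlgebraicComplexity.ArithCircuit` is a single-output straight-line
program without a gate set to act on, hence the DAG notion here. Nothing in this file is a named
fact; all lemmas are proved.
-/

noncomputable section

namespace Literature.Computability.AlgebraicComplexity

open MvPolynomial

universe u v w z

/-! ### Labels -/

/-- Gate labels of an arithmetic circuit over constants `K` and variables `X` (Dawar–Wilsenach
Def. 2.2: in-degree-`0` vertices carry a variable or a constant, internal vertices `+` or `×`).
[cite: DawarWilsenach2025, Def. 2.2] -/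
inductive CircuitLabel (K : Type u) (X : Type v) : Type max u v
  /-- Input gate labelled by the variable `x`. -/
  | var (x : X) : CircuitLabel K X
  /-- Input gate labelled by the constant `c`. -/
  | const (c : K) : CircuitLabel K X
  /-- Internal addition gate (unbounded fan-in). -/
  | add : CircuitLabel K X
  /-- Internal multiplication gate (unbounded fan-in). -/
  | mul : CircuitLabel K X

namespace CircuitLabel

variable {K : Type u} {X : Type v}

/-- Input labels: variables and constants. [cite: DawarWilsenach2025, Def. 2.2] -/
def IsInput : CircuitLabel K X → Prop
  | var _ => True
  | const _ => True
  | add => False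
  | mul => False

/-- Variables are input labels. [folklore] -/
@[simp] theorem isInput_var (x : X) : (var x : CircuitLabel K X).IsInput := trivial

/-- Constants are input labels. [folklore] -/
@[simp] theorem isInput_const (c : K) : (const c : CircuitLabel K X).IsInput := trivial

/-- `+` is not an input label. [folklore] -/
@[simp] theorem not_isInput_add : ¬ (add : CircuitLabel K X).IsInput := fun h => h

/-- `×` is not an input label. [folklore] -/
@[simp] theorem not_isInput_mul : ¬ (mul : CircuitLabel K X).IsInput := fun h => h

variable {Γ : Type w} [Group Γ] [MulAction Γ X]

/-- A group acting on the variables acts on labels: `γ • var x = var (γ • x)`, constants and the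
basis symbols are fixed (Dawar–Wilsenach Def. 3.6, first, second and fourth bullets).
[cite: DawarWilsenach2025, Def. 3.6] -/
instance instMulAction : MulAction Γ (CircuitLabel K X) where
  smul γ
    | var x => var (γ • x)
    | const c => const c
    | add => add
    | mul => mul
  one_smul l := by
    cases l with
    | var x => exact congrArg var (one_smul Γ x)
    | const c => rfl
    | add => rfl
    | mul => rfl
  mul_smul γ γ' l := by
    cases l with
    | var x => exact congrArg var (mul_smul γ γ' x)
    | const c => rfl
    | add => rfl
    | mul => rfl

/-- The action on a variable label. [cite: DawarWilsenach2025, Def. 3.6] -/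
@[simp] theorem smul_var (γ : Γ) (x : X) : γ • (var x : CircuitLabel K X) = var (γ • x) := rfl

/-- Constant labels are fixed. [cite: DawarWilsenach2025, Def. 3.6] -/
@[simp] theorem smul_const (γ : Γ) (c : K) : γ • (const c : CircuitLabel K X) = const c := rfl

/-- The label `+` is fixed. [cite: DawarWilsenach2025, Def. 3.6] -/
@[simp] theorem smul_add (γ : Γ) : γ • (add : CircuitLabel K X) = add := rfl

/-- The label `×` is fixed. [cite: DawarWilsenach2025, Def. 3.6] -/
@[simp] theorem smul_mul (γ : Γ) : γ • (mul : CircuitLabel K X) = mul := rfl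

/-- The action preserves being an input label. [cite: DawarWilsenach2025, Def. 3.6] -/
@[simp] theorem isInput_smul (γ : Γ) (l : CircuitLabel K X) : (γ • l).IsInput ↔ l.IsInput := by
  cases l <;> simp

end CircuitLabel

/-! ### Labelled arithmetic circuits (DAGs) -/

/-- **Arithmetic circuit as a labelled DAG** (Dawar–Wilsenach Def. 2.2, with designated outputs):
on the gate type `G`, `children g` is the set of gates wired into `g`, `label g` its label, the
child relation is well founded (acyclicity), a gate is an input gate (label in `X ∪ K`) iff it has
no children, distinct input gates have distinct labels, and `output : Y → G` designates output
gates injectively indexed by `Y` (a single output is `Y = Unit`; several outputs — e.g. the `n²`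
entries of a matrix product — are the route's generalisation, as in Anderson–Dawar Def. 4).
[cite: DawarWilsenach2025, Def. 2.2] -/
structure LabelledArithCircuit (K : Type u) (X : Type v) (Y : Type z) (G : Type w) where
  /-- `children g`: the gates `h` with a wire `(h, g)`. -/
  children : G → Finset G
  /-- The label of a gate. -/
  label : G → CircuitLabel K X
  /-- The designated output gates, indexed by `Y`. -/
  output : Y → G
  /-- Acyclicity: the child relation is well founded. -/
  wf : WellFounded fun h g => h ∈ children g
  /-- In-degree `0` exactly for gates labelled by a variable or a constant. -/
  isInput_iff : ∀ g, (label g).IsInput ↔ children g = ∅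
  /-- Distinct input gates have distinct labels. -/
  eq_of_label_eq : ∀ g g', (label g).IsInput → label g = label g' → g = g'
  /-- Distinct output indices designate distinct gates. -/
  output_injective : Function.Injective output

namespace LabelledArithCircuit

variable {K : Type u} {X : Type v} {Y : Type z} {G : Type w}

/-- The size of a circuit: its number of gates. [cite: DawarWilsenach2025, Def. 2.2] -/
def size [Fintype G] (_C : LabelledArithCircuit K X Y G) : ℕ := Fintype.card G

section Eval

variable [CommSemiring K] (C : LabelledArithCircuit K X Y G)

/-- **The polynomial computed at a gate** (Dawar–Wilsenach §2/§3.3): `var x ↦ X x`,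
`const c ↦ C c`, `add ↦ Σ_{h ∈ children} eval h`, `mul ↦ ∏_{h ∈ children} eval h`, by
well-founded recursion along the wires. [cite: DawarWilsenach2025, §2 (evaluation) and §3.3] -/
def eval : G → MvPolynomial X K :=
  C.wf.fix fun g rec =>
    match C.label g with
    | .var x => MvPolynomial.X x
    | .const c => MvPolynomial.C c
    | .add => ∑ h ∈ (C.children g).attach, rec h.1 h.2
    | .mul => ∏ h ∈ (C.children g).attach, rec h.1 h.2

/-- The defining equations of `eval`. [cite: DawarWilsenach2025, §2 (evaluation)] -/
theorem eval_eq (g : G) :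
    C.eval g =
      match C.label g with
      | .var x => MvPolynomial.X x
      | .const c => MvPolynomial.C c
      | .add => ∑ h ∈ C.children g, C.eval h
      | .mul => ∏ h ∈ C.children g, C.eval h := by
  rw [eval, WellFounded.fix_eq]
  split
  · rfl
  · rfl
  · exact Finset.sum_attach (C.children g) fun h => C.wf.fix _ h
  · exact Finset.prod_attach (C.children g) fun h => C.wf.fix _ h

/-- A variable gate evaluates to the formal variable. [cite: DawarWilsenach2025, §3.3] -/
theorem eval_of_label_var {g : G} {x : X} (h : C.label g = .var x) : C.eval g = MvPolynomial.X x := by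
  rw [eval_eq, h]

/-- A constant gate evaluates to the constant. [cite: DawarWilsenach2025, §3.3] -/
theorem eval_of_label_const {g : G} {c : K} (h : C.label g = .const c) :
    C.eval g = MvPolynomial.C c := by
  rw [eval_eq, h]

/-- An addition gate evaluates to the sum of its children. [cite: DawarWilsenach2025, §2 (evaluation)] -/
theorem eval_of_label_add {g : G} (h : C.label g = .add) :
    C.eval g = ∑ h ∈ C.children g, C.eval h := by
  rw [eval_eq, h]

/-- A multiplication gate evaluates to the product of its children. [cite: DawarWilsenach2025, §2 (evaluation)] -/
theorem eval_of_label_mul {g : G} (h : C.label g = .mul) :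
    C.eval g = ∏ h ∈ C.children g, C.eval h := by
  rw [eval_eq, h]

/-- `C` computes the family of polynomials `f : Y → K[X]` at its output gates.
[cite: DawarWilsenach2025, §2 ("the polynomial computed by C is the value of the output gate")] -/
def Computes (f : Y → MvPolynomial X K) : Prop := ∀ y, C.eval (C.output y) = f y

end Eval

/-! ### Automorphisms, symmetry, rigidity (Defs. 3.6–3.7) -/

section Symmetry

variable {Γ : Type*} [Group Γ] [MulAction Γ X] [MulAction Γ Y]

/-- **Circuit automorphism extending `γ`** (Dawar–Wilsenach Def. 3.6, with outputs): a
bijection `π` of the gates mapping the children of `g` onto the children of `π g` (wires to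
wires), acting on labels as `γ` does (`var x ↦ var (γ • x)`; constants, `+`, `×` preserved — and a
constant gate, its label being unique, is then fixed, `apply_eq_self_of_label_const`), and carrying
the output gate indexed `y` to the one indexed `γ • y`. For finite `G` "wires to wires" for a
bijection is equivalent to the equality of children sets used here. [cite: DawarWilsenach2025, Def. 3.6] -/
structure IsAutomorphismExtending (C : LabelledArithCircuit K X Y G) (γ : Γ) (π : Equiv.Perm G) :
    Prop where
  /-- Wires go to wires: `children (π g) = π '' children g`. -/
  children_apply : ∀ g, C.children (π g) = (C.children g).map π.toEmbedding
  /-- Labels transform under `γ`. -/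
  label_apply : ∀ g, C.label (π g) = γ • C.label g
  /-- Output gates are permuted as their indices. -/
  output_smul : ∀ y, C.output (γ • y) = π (C.output y)

/-- In an automorphism, constant gates are fixed (Def. 3.6, first bullet), because labels are
injective on input gates. [cite: DawarWilsenach2025, Def. 3.6] -/
theorem IsAutomorphismExtending.apply_eq_self_of_label_const {C : LabelledArithCircuit K X Y G}
    {γ : Γ} {π : Equiv.Perm G} (h : C.IsAutomorphismExtending γ π) {g : G} {c : K}
    (hg : C.label g = .const c) : π g = g :=
  C.eq_of_label_eq (π g) g (by rw [h.label_apply, hg]; simp) (by rw [h.label_apply, hg]; simp)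

/-- **`Γ`-symmetric circuit** (Dawar–Wilsenach Def. 3.7, verbatim form): the action of every
`γ ∈ Γ` on the variables extends to an automorphism of `C`. [cite: DawarWilsenach2025, Def. 3.7] -/
def IsSymmetric (Γ : Type*) [Group Γ] [MulAction Γ X] [MulAction Γ Y]
    (C : LabelledArithCircuit K X Y G) : Prop :=
  ∀ γ : Γ, ∃ π : Equiv.Perm G, C.IsAutomorphismExtending γ π

/-- **Rigid circuit** (Dawar–Wilsenach, after Def. 3.6): every `γ` has at most one extension to
an automorphism. [cite: DawarWilsenach2025, Def. 3.6 (rigid)] -/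
def IsRigid (Γ : Type*) [Group Γ] [MulAction Γ X] [MulAction Γ Y]
    (C : LabelledArithCircuit K X Y G) : Prop :=
  ∀ (γ : Γ) (π π' : Equiv.Perm G),
    C.IsAutomorphismExtending γ π → C.IsAutomorphismExtending γ π' → π = π'

end Symmetry

end LabelledArithCircuit

/-! ### Symmetric arithmetic circuits with the group acting on the gates -/

/-- **`Γ`-symmetric arithmetic circuit** (Dawar–Wilsenach Def. 3.7 in bundled form, as requested by
route `PriceOfSymmetry`): an arithmetic circuit (`LabelledArithCircuit`) whose gate type is a
`Γ`-set, such that every `g ↦ γ • g` is a circuit automorphism extending `γ` — wires to wires,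
`label (γ • g) = γ • label g` (the input `x` goes to the input `γ • x`; constants, `+`, `×` are
preserved), `output (γ • y) = γ • output y`. Such a circuit `IsSymmetric`; for rigid circuits the
two notions coincide (the unique extensions form an action — Dawar–Wilsenach's convention
"we write `σ g`"). Stabilisers, orbits and supports of gates are those of the `Γ`-action
(`MulAction.stabilizer`, `MulAction.orbit`, `IsSupport`). [cite: DawarWilsenach2025, Def. 3.7] -/
structure SymmetricArithmeticCircuit (Γ : Type*) (K : Type u) (X : Type v) (Y : Type z) (G : Type w)
    [Group Γ] [MulAction Γ X] [MulAction Γ Y] [MulAction Γ G]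
    extends LabelledArithCircuit K X Y G where
  /-- Wires go to wires: `children (γ • g) = γ • children g`. -/
  children_smul : ∀ (γ : Γ) (g : G),
    children (γ • g) = (children g).map (MulAction.toPerm γ : Equiv.Perm G).toEmbedding
  /-- Labels transform under `γ`. -/
  label_smul : ∀ (γ : Γ) (g : G), label (γ • g) = γ • label g
  /-- Output gates are permuted as their indices. -/
  output_smul : ∀ (γ : Γ) (y : Y), output (γ • y) = γ • output y

namespace SymmetricArithmeticCircuit

variable {Γ : Type*} {K : Type u} {X : Type v} {Y : Type z} {G : Type w}
  [Group Γ] [MulAction Γ X] [MulAction Γ Y] [MulAction Γ G]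
  (C : SymmetricArithmeticCircuit Γ K X Y G)

/-- Each group element acts by an automorphism extending it. [cite: DawarWilsenach2025, Defs. 3.6–3.7] -/
theorem isAutomorphismExtending_toPerm (γ : Γ) :
    C.toLabelledArithCircuit.IsAutomorphismExtending γ (MulAction.toPerm γ) :=
  ⟨C.children_smul γ, C.label_smul γ, C.output_smul γ⟩

/-- A `SymmetricArithmeticCircuit` is `Γ`-symmetric in the sense of Def. 3.7.
[cite: DawarWilsenach2025, Def. 3.7] -/
theorem isSymmetric : C.toLabelledArithCircuit.IsSymmetric Γ :=
  fun γ => ⟨MulAction.toPerm γ, C.isAutomorphismExtending_toPerm γ⟩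

/-- Membership in the children of a translated gate. [cite: DawarWilsenach2025, Def. 3.6] -/
theorem mem_children_smul_iff (γ : Γ) (g h : G) :
    h ∈ C.children (γ • g) ↔ γ⁻¹ • h ∈ C.children g := by
  rw [C.children_smul, Finset.mem_map]
  constructor
  · rintro ⟨h', hh', rfl⟩
    simpa using hh'
  · intro hh
    exact ⟨γ⁻¹ • h, hh, by simp⟩

/-- Constant gates are fixed by the action. [cite: DawarWilsenach2025, Def. 3.6 (first bullet)] -/
theorem smul_eq_self_of_label_const (γ : Γ) {g : G} {c : K} (hg : C.label g = .const c) : γ • g = g :=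
  (C.isAutomorphismExtending_toPerm γ).apply_eq_self_of_label_const hg

section Eval

variable [CommSemiring K]

/-- **Symmetric circuits compute equivariant polynomials** (Dawar–Wilsenach, remark after
Def. 3.7: "if a circuit is `Γ`-symmetric then it computes a `Γ`-symmetric polynomial"): the value
at `γ • g` is the value at `g` with the variables renamed by `γ`. [cite: DawarWilsenach2025, §3.2 (after Def. 3.7) and §3.3] -/
theorem eval_smul (γ : Γ) (g : G) :
    C.eval (γ • g) = MvPolynomial.rename (fun x : X => γ • x) (C.eval g) := by
  induction g using C.wf.induction with
  | h g ih =>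
    have hlab := C.label_smul γ g
    rcases hl : C.label g with x | c | _ | _
    · rw [hl, CircuitLabel.smul_var] at hlab
      rw [C.eval_of_label_var hl, C.eval_of_label_var hlab, rename_X]
    · rw [hl, CircuitLabel.smul_const] at hlab
      rw [C.eval_of_label_const hl, C.eval_of_label_const hlab, rename_C]
    · rw [hl, CircuitLabel.smul_add] at hlab
      rw [C.eval_of_label_add hl, C.eval_of_label_add hlab, map_sum, C.children_smul,
        Finset.sum_map]
      refine Finset.sum_congr rfl fun h hh => ?_
      exact ih h hh
    · rw [hl, CircuitLabel.smul_mul] at hlab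
      rw [C.eval_of_label_mul hl, C.eval_of_label_mul hlab, map_prod, C.children_smul,
        Finset.prod_map]
      refine Finset.prod_congr rfl fun h hh => ?_
      exact ih h hh

/-- In particular the outputs are equivariant: `eval (output (γ • y)) = rename γ (eval (output y))`.
[cite: DawarWilsenach2025, §3.2 (after Def. 3.7)] -/
theorem eval_output_smul (γ : Γ) (y : Y) :
    C.eval (C.output (γ • y)) = MvPolynomial.rename (fun x : X => γ • x) (C.eval (C.output y)) := by
  rw [C.output_smul, eval_smul]

end Eval

/-! ### Supports (Def. 6.1) -/

section Support

variable {U : Type*} {K' : Type u} {X' : Type v} {Y' : Type z} {G' : Type w}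
  [MulAction (Equiv.Perm U) X'] [MulAction (Equiv.Perm U) Y'] [MulAction (Equiv.Perm U) G']

/-- **Support of a gate** (Dawar–Wilsenach Def. 6.1, for circuits symmetric under `Γ = Sym(U)`
acting on variables indexed by `U`): `S ⊆ U` supports `g` if every permutation fixing `S`
pointwise fixes `g`, i.e. `Stab(S) ≤ Stab(g)` — Mathlib's `MulAction.Supports`.
[cite: DawarWilsenach2025, Def. 6.1] -/
def IsSupport (_C : SymmetricArithmeticCircuit (Equiv.Perm U) K' X' Y' G') (S : Set U) (g : G') :
    Prop :=
  MulAction.Supports (Equiv.Perm U) S g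

/-- `IsSupport` unfolded: permutations fixing `S` pointwise fix `g`. [cite: DawarWilsenach2025, Def. 6.1] -/
theorem isSupport_iff (C : SymmetricArithmeticCircuit (Equiv.Perm U) K' X' Y' G') (S : Set U) (g : G') :
    C.IsSupport S g ↔ ∀ σ : Equiv.Perm U, (∀ ⦃u⦄, u ∈ S → σ u = u) → σ • g = g :=
  Iff.rfl

/-- The whole index set supports every gate. [cite: DawarWilsenach2025, Def. 6.1] -/
theorem isSupport_univ (C : SymmetricArithmeticCircuit (Equiv.Perm U) K' X' Y' G') (g : G') :
    C.IsSupport Set.univ g := by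
  intro σ hσ
  have : σ = 1 := Equiv.ext fun u => hσ (Set.mem_univ u)
  rw [this, one_smul]

/-- `sp(g)`: the least size of a finite support of the gate `g` (Dawar–Wilsenach Def. 6.1); for
finite `U` the set is nonempty (`isSupport_univ`). [cite: DawarWilsenach2025, Def. 6.1 (sp)] -/
def minSupportSize (C : SymmetricArithmeticCircuit (Equiv.Perm U) K' X' Y' G') (g : G') : ℕ :=
  sInf {k : ℕ | ∃ S : Finset U, S.card = k ∧ C.IsSupport (S : Set U) g}

/-- `SP(C)`: the maximum over gates of `sp(g)`, the support size of the circuit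
(Dawar–Wilsenach Def. 6.1). [cite: DawarWilsenach2025, Def. 6.1 (SP)] -/
def supportSize [Fintype G'] (C : SymmetricArithmeticCircuit (Equiv.Perm U) K' X' Y' G') : ℕ :=
  Finset.univ.sup C.minSupportSize

/-- For finite `U`, `sp(g) ≤ |U|`. [cite: DawarWilsenach2025, Def. 6.1] -/
theorem minSupportSize_le_card [Fintype U] (C : SymmetricArithmeticCircuit (Equiv.Perm U) K' X' Y' G')
    (g : G') : C.minSupportSize g ≤ Fintype.card U :=
  Nat.sInf_le ⟨Finset.univ, Finset.card_univ, by simpa using C.isSupport_univ g⟩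

end Support

end SymmetricArithmeticCircuit

/-! ### The matrix-product instance (`Γ = S_n` acting on indices) -/

section MatMul

variable (n : ℕ)

/-- The input variables of `n × n` matrix multiplication: `A_ij` (`Sum.inl (i, j)`) and `B_jk`
(`Sum.inr (j, k)`); `S_n = Equiv.Perm (Fin n)` acts by simultaneous relabelling of indices
(Mathlib's diagonal actions on products and sums). [folklore] -/
abbrev MatMulVar (n : ℕ) : Type := (Fin n × Fin n) ⊕ (Fin n × Fin n)

variable {n} in
/-- The `(i, k)` entry of the matrix product as a polynomial: `Σ_j A_ij B_jk`. [folklore] -/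
def matMulEntry (K : Type u) [CommSemiring K] (i k : Fin n) : MvPolynomial (MatMulVar n) K :=
  ∑ j : Fin n, MvPolynomial.X (Sum.inl (i, j)) * MvPolynomial.X (Sum.inr (j, k))

/-- The matrix product is `S_n`-equivariant: relabelling indices by `σ` maps the `(i, k)` entry to
the `(σ i, σ k)` entry. [folklore] -/
theorem rename_matMulEntry (K : Type u) [CommSemiring K] (σ : Equiv.Perm (Fin n)) (i k : Fin n) :
    MvPolynomial.rename (fun x : MatMulVar n => σ • x) (matMulEntry K i k) =
      matMulEntry K (σ i) (σ k) := by
  simp only [matMulEntry, map_sum, map_mul, rename_X]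
  exact Fintype.sum_equiv σ _ _ fun j => rfl

/-- A circuit with inputs `MatMulVar n` and outputs indexed by `Fin n × Fin n` **computes the
`n × n` matrix product** if its output gate `(i, k)` evaluates to `Σ_j A_ij B_jk`. [folklore] -/
def LabelledArithCircuit.ComputesMatrixProduct {K : Type u} [CommSemiring K] {G : Type w}
    (C : LabelledArithCircuit K (MatMulVar n) (Fin n × Fin n) G) : Prop :=
  C.Computes fun ik => matMulEntry K ik.1 ik.2

end MatMul

end Literature.Computability.AlgebraicComplexity

end
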